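import Summits.BirchSwinnertonDyer.BirchSwinnertonDyer.Theorems.SchneiderFreeAdditiveX3GordCellFiveLe
import Summits.BirchSwinnertonDyer.BirchSwinnertonDyer.Theorems.SchneiderFreeAdditiveX3GordCellThreePerPair
import Summits.BirchSwinnertonDyer.BirchSwinnertonDyer.Theorems.SchneiderFreeAdditiveX3GordCellThreeAnomalousClass
import Summits.BirchSwinnertonDyer.BirchSwinnertonDyer.Theorems.SchneiderFreeAdditiveX3UpperGordCellOfPrintDvdOnly
import HarnessLib

/-!
# Route `SchneiderFreeAdditiveX3` (K1 door): BSD_p PER PAIR on the (G-ord, `e = 2`) cell AT `p ≥ 5` — the LOWER half `ord_p #Ш_an ≤ ord_p #Ш` with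
# NO per-pair hypothesis, both halves with the twist-unit datum — and the LOWER half on the WHOLE (G-ord, `e = 2`) half of B6 ∩ X3 at EVERY odd prime

Cell `bsd-schneider-ideate`, seat `bsd-schneider-door-c5` (prover, generation 33; assembly layer; `--supports` 19177).
PARTITION: board row B6 ∩ X3 ∩ sst-twist, `r = 1`, (G-ord, `e = 2`) half (2 560 of 7 101 pairs: 149 at `p ≥ 5`, 2 411 at `p = 3`; class-wide every
odd `p`) of `Rank1Residual.partition` — types-the-object-of nothing new; DERIVES the per-pair halves at `p ≥ 5` exactly as generation 27 did at
`p = 3` (`…GordCellThreePerPair`), from the per-datum door of `…GordCellFiveLe` §2; closes none of B6's cells (BSD NOT advanced: every statement is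
CONDITIONAL on displayed named facts incl. two preprint sentences).  bears_on: K1-door (19177 r3) + K1-wing (20365: the upper half consumed).

* §1 **`missingLowerBoundAt_gordTwo_five_le`** — `MissingLowerBoundAt W p` (`ord_p #Ш(E)_an ≤ ord_p #Ш(E)`) for EVERY globally minimal `W/ℚ` with
  `r_an = 1`, `p ≥ 5`, `ClassX3 W p`, `SubGordTwo W p` ⟸ `PrintedFacts` ∧ Hsieh 2014 Thm A ∧ LZZ 2018 ∧ Castella–Hsieh signed ∧ [DIV.dvd] (PRE) ∧
  [AN-BR₅] (PRE + Rubin) ∧ eight published facts (+ Greenberg 2006 Prop 4.2 / §5 A as tree theorems).  Generation 21/27's proof: the Heegner/twist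
  datum with `d_K ≡ 1 (mod 8)` (Friedberg–Hoffstein; `d_K ≠ −3`, so the sliver never enters), STEP L at it from the per-datum door
  `KYBranchFiveLeDoor.additiveIMCLowerBDPOnTree_subGordTwo_five_le_offSliver` + the control inequality (CLOSED corner + Kolyvagin), `Ш(E/K)` finite by
  Kolyvagin, then `JointLowerManin` / `PartnerUpperRankZero` (both PROVED route items).
* §2 `missingPPartAt_gordTwo_five_le_of_twistUnitAt` / `bsdp_gordTwo_five_le_of_twistUnitAt` — BOTH halves and Miller's `BSD(E, p)` per pair at `p ≥ 5`
  with the pair's twist-unit datum (upper half: generation 23's `UpperOfPrintDvd.missingUpperBoundAt_gordTwo_fiveLe_…_KY_dvd_of_prop14_…`, ⟸ PUB ∪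
  {[DIV.dvd]} ∪ {TU}).
* §3 **`missingLowerBoundAt_gordTwo`** — the LOWER half per pair on the WHOLE (G-ord, `e = 2`) half at EVERY odd prime: `p = 3` is generation 32's
  `KYBranchThreeAnomalousClass.missingLowerBoundAt_gordTwo_three` (2 411 pairs, NAT ⊕ anomalous, class-wide), `p ≥ 5` is §1;
  `missingPPartAt_gordTwo_of_twistUnitAt` / `bsdp_gordTwo_of_twistUnitAt` — both halves / `BSD(E, p)` with TU at every odd `p`.

INPUT LEDGER per pair, (G-ord, `e = 2`), LOWER half: `p ≥ 5`: PUB ∪ {[DIV.dvd], [AN-BR₅]}; `p = 3`: PUB ∪ {[DIV.dvd], [AN3]/[AN3-all] (PUB-composed,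
audit pending), [BR3] (PUB), [RH], [PWL-θ]}; NO sliver input (the datum is chosen with `d_K ≡ 1 (mod 8)`), NO per-pair hypothesis.  BOTH halves: + TU
(certified per census pair by kit; class-wide = wing r2, OPEN).

HONEST FRAMING: compositions of tree theorems, CONDITIONAL on every displayed hypothesis ([DIV.dvd], [AN3]/[AN3-all], [AN-BR₅] carry Keller–Yin claim
tags — unrefereed preprint); no definition, no named fact, no `sorry`; closes no item; BSD is proved for NO curve («closes rung: none»).
References: Keller–Yin arXiv:2410.23241 Thm. 3.3.6, Prop. 3.4.4, §3.5, Thm. 3.5.1, Lemma 2.3.8 [KellerYin2024b]; CGLS 2022 [CastellaGrossiLeeSkinner2022];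
Friedberg–Hoffstein 1995 Thm B [FriedbergHoffstein1995]; Gross–Zagier 1986 I.(6.3), (7.3) [GrossZagier1986]; Jetchev–Skinner–Wan 2017 §7.4.1
[JetchevSkinnerWan2017]; Miller 2011 Def. 1.1 [Miller2011LMS]; this seat p684036/p684532 (gen 27), p666793/p675460 (gen 23/25), p727699 (gen 32).
-/

set_option autoImplicit false
-- `Summit.<P>.<Sub>` repeats `BirchSwinnertonDyer` by the tree's layout convention (D-0017)
set_option linter.dupNamespace false

noncomputable section

open scoped Classical NumberField

open Field NumberField IsDedekindDomain WeierstrassCurve PowerSeries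
  Literature.NumberTheory.EllipticCurves Literature.NumberTheory.EllipticCurves.GreenbergSelmer
  Literature.NumberTheory.GaloisRepresentations Literature.NumberTheory.GaloisCohomology
  Literature.NumberTheory.EllipticCurves.ModularForms Literature.NumberTheory.EllipticCurves.Rank1Residual
  Literature.NumberTheory.EllipticCurves.Rank1Residual.Typed
  Literature.NumberTheory.EllipticCurves.KellerYin2024 Literature.NumberTheory.EllipticCurves.CaiShuTian2014
  Literature.NumberTheory.IwasawaTheory Literature.NumberTheory.IwasawaTheory.Greenberg2016
  Literature.NumberTheory.IwasawaTheory.Greenberg2006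
  Literature.NumberTheory.EllipticCurves.Rubin1991 Literature.NumberTheory.EllipticCurves.DeShalit1987
  Literature.NumberTheory.EllipticCurves.Hida2010MuInvariant Literature.NumberTheory.EllipticCurves.BCGKPST2020
  Summit.BirchSwinnertonDyer.Rank1Residual Summit.BirchSwinnertonDyer.Rank1Residual.X11b
  Summit.BirchSwinnertonDyer.Rank1Residual.X11b.AcSelmer Summit.BirchSwinnertonDyer.Rank1Residual.X11b.Halves
  Summit.BirchSwinnertonDyer.Rank1Residual.Additive Summit.BirchSwinnertonDyer.Rank1Residual.GaloisImage
  Summit.BirchSwinnertonDyer.BirchSwinnertonDyer.Theorems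
  Summit.BirchSwinnertonDyer.BirchSwinnertonDyer.Theorems.EisensteinPrimesMuLambda
  Summit.BirchSwinnertonDyer.BirchSwinnertonDyer.Theorems.SchneiderFree
  Summit.BirchSwinnertonDyer.BirchSwinnertonDyer.Theorems.SchneiderFree.Upper
  Summit.BirchSwinnertonDyer.BirchSwinnertonDyer.Theorems.SchneiderFree.KYRead
  Summit.BirchSwinnertonDyer.BirchSwinnertonDyer.Theses.SchneiderFreeAdditiveX3
  Summit.BirchSwinnertonDyer.BirchSwinnertonDyer.Theorems.SchneiderFreeAdditiveX3.ControlDischarged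
  Summit.BirchSwinnertonDyer.BirchSwinnertonDyer.Theorems.SchneiderFreeAdditiveX3.KYBranchOnly
  Summit.BirchSwinnertonDyer.BirchSwinnertonDyer.Theorems.SchneiderFreeAdditiveX3.KYBranchFiveLeDoor
  Summit.BirchSwinnertonDyer.BirchSwinnertonDyer.Theorems.SchneiderFreeAdditiveX3.KYBranchThreeAnomalousClass
  Summit.BirchSwinnertonDyer.BirchSwinnertonDyer.Theorems.SchneiderFreeAdditiveX3.UpperOfPrintDvd
open Literature.NumberTheory.EllipticCurves.CastellaGrossiLeeSkinner2022
  (prop14_residualCharacterSelmer_finite thm212_exists_isKatzLFunction prop125_characterGrSelmerDual_torsion_muZero_dim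
    cor126_residualCharacter_globalLift cor126_residualCharacter_localSurjective)
open Literature.NumberTheory.EllipticCurves.KellerYin2024 (thm122_rubinHida_residualPair_unrSelmer prop125_residualPair_unrSelmer_imprimitive
  thm351_anacong_branch_three_allTwists thm351_anacong_charLambda_branch_five_le)

namespace Summit.BirchSwinnertonDyer.BirchSwinnertonDyer.Theorems.SchneiderFreeAdditiveX3.KYBranchFiveLePerPair

/-! ### §1 The LOWER half per pair on (G-ord, `e = 2`) at `p ≥ 5` — no per-pair hypothesis -/

/-- **LOWER half per pair on the (G-ord, `e = 2`) cell AT `p ≥ 5` ⇐ `PrintedFacts` ∧ Hsieh 2014 Thm. A ∧ Liu–Zhang–Zhang 2018 ∧ Castella–Hsieh signed ∧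
[DIV.dvd] (PREPRINT) ∧ [AN-BR₅] (PREPRINT sentence + Rubin) ∧ CGLS Props 1.2.5, 14, Cor 1.2.6 ×2 ∧ Greenberg 2016 4.1.1/2.6.3 ∧ Greenberg 2006 4.1/3.2
— NO crux, NO Keller–Yin CONCLUSION, NO per-pair hypothesis, NO sliver input.**  For every globally minimal `W/ℚ` with `r_an = 1`, `p ≥ 5`, `ClassX3 W p`,
`SubGordTwo W p`: `MissingLowerBoundAt W p` (`ord_p #Ш(E)_an ≤ ord_p #Ш(E)`).  Generation 27's `KYBranchThreePerPair.missingLowerBoundAt_gordTwo_three_…`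
proof at `p ≥ 5`: the Heegner/twist datum with `d_K ≡ 1 (mod 8)` (Friedberg–Hoffstein; `d_K ≠ −3`), STEP L at it from the per-datum door
`KYBranchFiveLeDoor.additiveIMCLowerBDPOnTree_subGordTwo_five_le_offSliver` + the control inequality (CLOSED corner + Kolyvagin), `Ш(E/K)` finite by
Kolyvagin, then `JointLowerManin` / `PartnerUpperRankZero`.  CONDITIONAL on the displayed hypotheses; closes no item; BSD not advanced beyond this typed
reduction. [claim: KellerYin2024PotOrd, status: under-review]
[cite: KellerYin2024b, Thm. 3.3.6, Prop. 3.4.4, §3.5, Thm. 3.5.1 and Lemma 2.3.8 (arXiv:2410.23241 pp. 11, 19–20) (preprint; hypotheses)]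
[cite: CastellaGrossiLeeSkinner2022, Thm. 1.2.2, Props. 1.2.5, 14, Cor. 1.2.6] [cite: JetchevSkinnerWan2017, §7.4.1 (arXiv:1512.06894 p. 30)]
[cite: FriedbergHoffstein1995, Thm. B] [cite: GrossZagier1986, Thm. I.(6.3) and (7.3)] -/
theorem missingLowerBoundAt_gordTwo_five_le (hF : PrintedFacts)
    (hA : Hsieh2014.thmA_exists_isHsiehLFunction_unrPeriod_anyLevel)
    (hL : LiuZhangZhang2018.thm151_thm153_modularCurve_heegnerVector_additive)
    (hCHσ : castellaHsieh2018_exists_isBranchBDPLFunction_signed)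
    (hDVD : thm336_dvd_branch_OPEN) (hAN : thm351_anacong_charLambda_branch_five_le)
    (hprop125 : prop125_characterGrSelmerDual_torsion_muZero_dim) (hfact : prop14_residualCharacterSelmer_finite)
    (hlift : cor126_residualCharacter_globalLift) (hlocal : cor126_residualCharacter_localSurjective)
    (h411 : prop411_selmer_isAlmostDivisible) (h263 : prop263_sur_of_crk) (h41 : prop41_globalEulerPoincareCorank)
    (h32 : prop32_cohomology_isCofinitelyGenerated) :
    ∀ (W : WeierstrassCurve ℚ) [W.IsElliptic] [W.IsGloballyMinimal] (p : ℕ) [Fact p.Prime],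
      5 ≤ p → W.analyticRank = 1 → ClassX3 W p → Additive.SubGordTwo W p → MissingLowerBoundAt W p := by
  have hJ : JointLowerManin := schneiderFreeAdditiveX3_jointLowerManin_proof
  have hU : PartnerUpperRankZero := schneiderFreeAdditiveX3_partnerUpperRankZero_proof
  obtain ⟨hGZ, hKo, hGZK, hmod, hmodD, hCas, hGZ73, hFH, hpar, hHP, hDel, hW16, hWu⟩ := hF
  intro W _ _ p _ hp5 hr hX hG
  have hp2 : p ≠ 2 := by omega
  have hS : Additive.SubSemistableTwist W p := Or.inr hG
  -- the Heegner/twist datum with `d_K ≡ 1 (mod 8)`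
  obtain ⟨N, _, K, _, _, Dt, H, ι, P, Wd, _, _, hN, hKiq, hodd, hunit, hHe, hLtw, hP, hnt, hWd, hrd, hXd, hSd, h8⟩ :=
    exists_heegnerTwistDataManin_discr_emod_eight hFH hpar hHP hGZ hmod W p hr hp2 hX hS
  have hdK : NumberField.discr K ≠ -3 := discr_ne_neg_three_of_emod_eight h8
  have hloc : Additive.N10.Locus W p :=
    (Additive.N10.locus_iff_cells W p).mpr
      ((Additive.N10.cellM_or_cellGordTwo_of_classX3_of_subSemistableTwist W p hp2 hX hS).elim Or.inl
        (fun h ↦ Or.inr (Or.inl h)))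
  -- STEP L at THIS datum
  have hfin : (W.baseChange K).ShaFinite := (hKo N W K hKiq hHe ⟨Dt, H, ι, hP⟩ hnt).2
  have hidx : IndexLowerBoundLeAt W p K P (padicValNat p Dt.c.natAbs) := by
    refine indexLowerBoundLeAt_of_frames_of_shaFinite_le hloc hN hKiq hHe hfin ?_ ?_
    · intro κ hκ γ _ 𝔭 h𝔭 he hf
      exact KYBranchFiveLeDoor.additiveIMCLowerBDPOnTree_subGordTwo_five_le_offSliver hKo hmodD hA hL hCHσ hDVD hAN hprop125 hfact hlift
        hlocal h411 h263 h41 Greenberg2006.prop42_localEulerPoincareCorank_holds Greenberg2006.sec5A_localH2_subsingleton_of_LOC1_holds h32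
        hp5 W hr hX hG N K Dt H ι P hr hloc hN hKiq hodd hunit hHe hLtw hP hnt hdK κ hκ γ 𝔭 h𝔭 he hf
    · intro κ hκ γ _ 𝔭 h𝔭 he hf
      exact additiveControlLeOnTreeAt_of_pt_of_kolyvagin pt_selmer_forall hKo W p hr hp2 hX hS N K Dt H ι P hr hloc hN hKiq
        hodd hunit hHe hLtw hP hnt κ hκ γ 𝔭 h𝔭 he hf
  have hJ' : JointLowerBoundAt W Wd p :=
    hJ hGZ hKo hGZK hmod hmodD hCas hGZ73 W p N K Dt H ι P Wd hr hN hKiq hodd hunit hHe hLtw hP hnt hWd hrd hp2 hidx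
  exact missingLowerBoundAt_of_joint_of_upper hJ' (hU hDel hGZK hmod hmodD hW16 hWu Wd p hrd hp2 hXd hSd)

/-! ### §2 Both halves per pair at `p ≥ 5`: `MissingPPartAt W p` and Miller's `BSD(E, p)` with the twist-unit datum -/

/-- **BOTH halves per pair on the (G-ord, `e = 2`) cell AT `p ≥ 5`: `MissingPPartAt W p` (`ord_p #Ш(E)_an = ord_p #Ш(E)`) ⇐ §1's inputs ∧ the pair's
twist-unit datum** — §1 (lower) and generation 23's `UpperOfPrintDvd.missingUpperBoundAt_gordTwo_fiveLe_…` (upper, ⟸ PUB ∪ {[DIV.dvd]} ∪ {TU}) through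
`missingPPartAt_of_lower_of_upper`.  On the census (149 (G-ord) pairs at `p ≥ 5`) TU is a kit certificate per pair; class-wide it is wing r2 (OPEN).
CONDITIONAL; closes no item; BSD not advanced beyond this typed reduction. [claim: KellerYin2024PotOrd, status: under-review]
[cite: Miller2011LMS, Def. 1.1] [cite: KellerYin2024b, Thm. 3.3.6, Prop. 3.4.4 and §3.5 (arXiv:2410.23241 pp. 19–20) (preprint; hypotheses)]
[cite: CastellaGrossiLeeSkinner2022, Thm. 1.2.2, Props. 1.2.5, 14, Cor. 1.2.6] -/
theorem missingPPartAt_gordTwo_five_le_of_twistUnitAt (hF : PrintedFacts)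
    (hA : Hsieh2014.thmA_exists_isHsiehLFunction_unrPeriod_anyLevel)
    (hL : LiuZhangZhang2018.thm151_thm153_modularCurve_heegnerVector_additive)
    (hCHσ : castellaHsieh2018_exists_isBranchBDPLFunction_signed)
    (hDVD : thm336_dvd_branch_OPEN) (hAN : thm351_anacong_charLambda_branch_five_le)
    (hprop125 : prop125_characterGrSelmerDual_torsion_muZero_dim) (hfact : prop14_residualCharacterSelmer_finite)
    (hlift : cor126_residualCharacter_globalLift) (hlocal : cor126_residualCharacter_localSurjective)
    (h411 : prop411_selmer_isAlmostDivisible) (h263 : prop263_sur_of_crk) (h41 : prop41_globalEulerPoincareCorank)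
    (h32 : prop32_cohomology_isCofinitelyGenerated) :
    ∀ (W : WeierstrassCurve ℚ) [W.IsElliptic] [W.IsGloballyMinimal] (p : ℕ) [Fact p.Prime],
      5 ≤ p → W.analyticRank = 1 → ClassX3 W p → Additive.SubGordTwo W p → Upper.TwistUnitFieldOffSliverAt W p → MissingPPartAt W p :=
  fun W _ _ p _ hp5 hr hX hG hTU =>
    missingPPartAt_of_lower_of_upper W p
      (missingLowerBoundAt_gordTwo_five_le hF hA hL hCHσ hDVD hAN hprop125 hfact hlift hlocal h411 h263 h41 h32 W p hp5 hr hX hG)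
      (missingUpperBoundAt_gordTwo_fiveLe_of_printedFacts_of_twistUnitAt_of_hsieh_of_lzz_of_KY_dvd_of_prop14_of_castellaHsieh_signed hF hA hL
        hDVD hfact hCHσ W p hp5 hr hX hG hTU)

/-- **Miller's `BSD(E, p)` per pair on the (G-ord, `e = 2`) cell AT `p ≥ 5` from the TU datum** — the previous theorem through `bsdp_of_missingPPartAt` (rank =
analytic rank and `Ш` finite by GZK, conjunct 3 of `PrintedFacts`).  NOT a proof of BSD for any curve: at each of the 149 (G-ord) census pairs at `p ≥ 5` it
is BSD_p MODULO {published theorems} ∪ {[DIV.dvd], [AN-BR₅] (preprint)} ∪ {the pair's TU certificate}. [claim: KellerYin2024PotOrd, status: under-review]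
[cite: Miller2011LMS, §1 and Def. 1.1] [cite: KellerYin2024b, Thm. 3.3.6, Prop. 3.4.4 and §3.5 (arXiv:2410.23241 pp. 19–20) (preprint; hypotheses)] -/
theorem bsdp_gordTwo_five_le_of_twistUnitAt (hF : PrintedFacts)
    (hA : Hsieh2014.thmA_exists_isHsiehLFunction_unrPeriod_anyLevel)
    (hL : LiuZhangZhang2018.thm151_thm153_modularCurve_heegnerVector_additive)
    (hCHσ : castellaHsieh2018_exists_isBranchBDPLFunction_signed)
    (hDVD : thm336_dvd_branch_OPEN) (hAN : thm351_anacong_charLambda_branch_five_le)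
    (hprop125 : prop125_characterGrSelmerDual_torsion_muZero_dim) (hfact : prop14_residualCharacterSelmer_finite)
    (hlift : cor126_residualCharacter_globalLift) (hlocal : cor126_residualCharacter_localSurjective)
    (h411 : prop411_selmer_isAlmostDivisible) (h263 : prop263_sur_of_crk) (h41 : prop41_globalEulerPoincareCorank)
    (h32 : prop32_cohomology_isCofinitelyGenerated) :
    ∀ (W : WeierstrassCurve ℚ) [W.IsElliptic] [W.IsGloballyMinimal] (p : ℕ) [Fact p.Prime],
      5 ≤ p → W.analyticRank = 1 → ClassX3 W p → Additive.SubGordTwo W p → Upper.TwistUnitFieldOffSliverAt W p → BSDp W p :=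
  fun W _ _ p _ hp5 hr hX hG hTU =>
    bsdp_of_missingPPartAt W p hF.2.2.1 (le_of_eq hr)
      (missingPPartAt_gordTwo_five_le_of_twistUnitAt hF hA hL hCHσ hDVD hAN hprop125 hfact hlift hlocal h411 h263 h41 h32 W p hp5 hr hX hG hTU)

/-! ### §3 The WHOLE (G-ord, `e = 2`) half of B6 ∩ X3 at EVERY odd prime -/

/-- **The LOWER half `ord_p #Ш(E)_an ≤ ord_p #Ш(E)` PER PAIR on the WHOLE (G-ord, `e = 2`) half of B6 ∩ X3 at EVERY odd prime `p`, NO per-pair hypothesis**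
⇐ `PrintedFacts` ∧ Hsieh A ∧ LZZ ∧ Castella–Hsieh signed ∧ [DIV.dvd] (PRE) ∧ the typed analytic sentences {`p = 3`: [AN3] (hna-free; PUB-composed, audit
pending) ∧ [BR3] (PUB) ∧ CGLS Thm 2.1.2 ∧ [RH] ∧ [PWL-θ] ∧ Rubin 1991 ∧ de Shalit II.6.4 ∧ Hida Thm I} ∧ {`p ≥ 5`: [AN-BR₅] (PRE + Rubin)} ∧ CGLS Props
1.2.5, 14, Cor 1.2.6 ×2 ∧ Greenberg 2016 4.1.1/2.6.3 ∧ Greenberg 2006 4.1/3.2.  By cases on the odd prime: `p = 3` is generation 32's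
`KYBranchThreeAnomalousClass.missingLowerBoundAt_gordTwo_three` (2 411 pairs), `p ≥ 5` is §1 (149 pairs).  CONDITIONAL on every displayed hypothesis;
closes no item; BSD not advanced beyond this typed reduction. [claim: KellerYin2024PotOrd, status: under-review]
[cite: KellerYin2024b, Thm. 3.3.6, Prop. 3.4.4, §3.5, Thm. 3.5.1 and Lemma 2.3.8 (arXiv:2410.23241 pp. 11, 19–20) (preprint; hypotheses)]
[cite: CastellaGrossiLeeSkinner2022, Thms. 1.2.2, 2.1.2, 2.2.2, Props. 1.2.5, 14, Cor. 1.2.6] [cite: KellerYin2024, Thms. 1.2.2, 2.2.2 (arXiv:2402.12781v2)]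
[cite: JetchevSkinnerWan2017, §7.4.1] [cite: FriedbergHoffstein1995, Thm. B] -/
theorem missingLowerBoundAt_gordTwo (hF : PrintedFacts)
    (hA : Hsieh2014.thmA_exists_isHsiehLFunction_unrPeriod_anyLevel)
    (hL : LiuZhangZhang2018.thm151_thm153_modularCurve_heegnerVector_additive)
    (hCHσ : castellaHsieh2018_exists_isBranchBDPLFunction_signed)
    (hDVD : thm336_dvd_branch_OPEN)
    (hAN3 : thm351_anacong_branch_three_allTwists) (hBR3 : thm122_charLambda_pair_three) (h212 : thm212_exists_isKatzLFunction)
    (hAN5 : thm351_anacong_charLambda_branch_five_le)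
    (hprop125 : prop125_characterGrSelmerDual_torsion_muZero_dim) (hfact : prop14_residualCharacterSelmer_finite)
    (hlift : cor126_residualCharacter_globalLift) (hlocal : cor126_residualCharacter_localSurjective)
    (hRH : thm122_rubinHida_residualPair_unrSelmer) (hPWL : prop125_residualPair_unrSelmer_imprimitive)
    (h331 : thm331_rubin_exists_katzMeasure₂_pseudoIso_span_eq) (h411 : prop411_selmer_isAlmostDivisible)
    (hFE : thmII64_katzMeasure₂_functionalEquation) (hO1 : thmI_mu_katzBranch_reflect_eq_zero)
    (h263 : prop263_sur_of_crk) (h41 : prop41_globalEulerPoincareCorank) (h32 : prop32_cohomology_isCofinitelyGenerated) :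
    ∀ (W : WeierstrassCurve ℚ) [W.IsElliptic] [W.IsGloballyMinimal] (p : ℕ) [Fact p.Prime],
      W.analyticRank = 1 → p ≠ 2 → ClassX3 W p → Additive.SubGordTwo W p → MissingLowerBoundAt W p := by
  intro W _ _ p _ hr hp2 hX hG
  have hp : p.Prime := Fact.out
  -- an odd prime is `3` or `≥ 5` (inline: the tree's `InertBadOffTprime.eq_three_or_five_le_of_prime_of_ne_two` lives in another route's import cone)
  obtain rfl | hp5 : p = 3 ∨ 5 ≤ p := by
    rcases Nat.lt_or_ge p 5 with h | h
    · left
      have h2 := hp.two_le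
      interval_cases p
      · exact absurd rfl hp2
      · rfl
      · exact absurd hp (by norm_num)
    · exact Or.inr h
  · exact KYBranchThreeAnomalousClass.missingLowerBoundAt_gordTwo_three hF hA hL hCHσ hDVD hAN3.to_branch_three hAN3 hBR3 h212 hprop125 hfact
      hlift hlocal hRH hPWL h331 h411 hFE hO1 h263 h41 h32 W hr hX hG
  · exact missingLowerBoundAt_gordTwo_five_le hF hA hL hCHσ hDVD hAN5 hprop125 hfact hlift hlocal h411 h263 h41 h32 W p hp5 hr hX hG

/-- **BOTH halves per pair on the WHOLE (G-ord, `e = 2`) half at EVERY odd prime from the TU datum: `MissingPPartAt W p`** — `p = 3`: generation 32's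
`missingPPartAt_gordTwo_three_of_twistUnitAt`; `p ≥ 5`: §2.  CONDITIONAL; closes no item; BSD not advanced beyond this typed reduction.
[claim: KellerYin2024PotOrd, status: under-review] [cite: Miller2011LMS, Def. 1.1]
[cite: KellerYin2024b, Thm. 3.3.6, Prop. 3.4.4, §3.5 (arXiv:2410.23241 pp. 19–20) (preprint; hypotheses)] -/
theorem missingPPartAt_gordTwo_of_twistUnitAt (hF : PrintedFacts)
    (hA : Hsieh2014.thmA_exists_isHsiehLFunction_unrPeriod_anyLevel)
    (hL : LiuZhangZhang2018.thm151_thm153_modularCurve_heegnerVector_additive)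
    (hCHσ : castellaHsieh2018_exists_isBranchBDPLFunction_signed)
    (hDVD : thm336_dvd_branch_OPEN)
    (hAN3 : thm351_anacong_branch_three_allTwists) (hBR3 : thm122_charLambda_pair_three) (h212 : thm212_exists_isKatzLFunction)
    (hAN5 : thm351_anacong_charLambda_branch_five_le)
    (hprop125 : prop125_characterGrSelmerDual_torsion_muZero_dim) (hfact : prop14_residualCharacterSelmer_finite)
    (hlift : cor126_residualCharacter_globalLift) (hlocal : cor126_residualCharacter_localSurjective)
    (hRH : thm122_rubinHida_residualPair_unrSelmer) (hPWL : prop125_residualPair_unrSelmer_imprimitive)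
    (h331 : thm331_rubin_exists_katzMeasure₂_pseudoIso_span_eq) (h411 : prop411_selmer_isAlmostDivisible)
    (hFE : thmII64_katzMeasure₂_functionalEquation) (hO1 : thmI_mu_katzBranch_reflect_eq_zero)
    (h263 : prop263_sur_of_crk) (h41 : prop41_globalEulerPoincareCorank) (h32 : prop32_cohomology_isCofinitelyGenerated) :
    ∀ (W : WeierstrassCurve ℚ) [W.IsElliptic] [W.IsGloballyMinimal] (p : ℕ) [Fact p.Prime],
      W.analyticRank = 1 → p ≠ 2 → ClassX3 W p → Additive.SubGordTwo W p → Upper.TwistUnitFieldOffSliverAt W p → MissingPPartAt W p := by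
  intro W _ _ p _ hr hp2 hX hG hTU
  have hp : p.Prime := Fact.out
  -- an odd prime is `3` or `≥ 5` (inline: the tree's `InertBadOffTprime.eq_three_or_five_le_of_prime_of_ne_two` lives in another route's import cone)
  obtain rfl | hp5 : p = 3 ∨ 5 ≤ p := by
    rcases Nat.lt_or_ge p 5 with h | h
    · left
      have h2 := hp.two_le
      interval_cases p
      · exact absurd rfl hp2
      · rfl
      · exact absurd hp (by norm_num)
    · exact Or.inr h
  · exact KYBranchThreeAnomalousClass.missingPPartAt_gordTwo_three_of_twistUnitAt hF hA hL hCHσ hDVD hAN3.to_branch_three hAN3 hBR3 h212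
      hprop125 hfact hlift hlocal hRH hPWL h331 h411 hFE hO1 h263 h41 h32 W hr hX hG hTU
  · exact missingPPartAt_gordTwo_five_le_of_twistUnitAt hF hA hL hCHσ hDVD hAN5 hprop125 hfact hlift hlocal h411 h263 h41 h32 W p hp5 hr hX
      hG hTU

/-- **Miller's `BSD(E, p)` per pair on the WHOLE (G-ord, `e = 2`) half at EVERY odd prime from the TU datum** — the previous theorem through
`bsdp_of_missingPPartAt`.  NOT a proof of BSD for any curve: BSD_p MODULO {published theorems} ∪ {[DIV.dvd], the typed analytic sentences (preprint /
PUB-composed audit pending), [RH], [PWL-θ]} ∪ {the pair's TU certificate}. [claim: KellerYin2024PotOrd, status: under-review] [cite: Miller2011LMS, §1 and Def. 1.1]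
[cite: KellerYin2024b, Thm. 3.3.6, Prop. 3.4.4, §3.5 (arXiv:2410.23241 pp. 19–20) (preprint; hypotheses)] -/
theorem bsdp_gordTwo_of_twistUnitAt (hF : PrintedFacts)
    (hA : Hsieh2014.thmA_exists_isHsiehLFunction_unrPeriod_anyLevel)
    (hL : LiuZhangZhang2018.thm151_thm153_modularCurve_heegnerVector_additive)
    (hCHσ : castellaHsieh2018_exists_isBranchBDPLFunction_signed)
    (hDVD : thm336_dvd_branch_OPEN)
    (hAN3 : thm351_anacong_branch_three_allTwists) (hBR3 : thm122_charLambda_pair_three) (h212 : thm212_exists_isKatzLFunction)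
    (hAN5 : thm351_anacong_charLambda_branch_five_le)
    (hprop125 : prop125_characterGrSelmerDual_torsion_muZero_dim) (hfact : prop14_residualCharacterSelmer_finite)
    (hlift : cor126_residualCharacter_globalLift) (hlocal : cor126_residualCharacter_localSurjective)
    (hRH : thm122_rubinHida_residualPair_unrSelmer) (hPWL : prop125_residualPair_unrSelmer_imprimitive)
    (h331 : thm331_rubin_exists_katzMeasure₂_pseudoIso_span_eq) (h411 : prop411_selmer_isAlmostDivisible)
    (hFE : thmII64_katzMeasure₂_functionalEquation) (hO1 : thmI_mu_katzBranch_reflect_eq_zero)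
    (h263 : prop263_sur_of_crk) (h41 : prop41_globalEulerPoincareCorank) (h32 : prop32_cohomology_isCofinitelyGenerated) :
    ∀ (W : WeierstrassCurve ℚ) [W.IsElliptic] [W.IsGloballyMinimal] (p : ℕ) [Fact p.Prime],
      W.analyticRank = 1 → p ≠ 2 → ClassX3 W p → Additive.SubGordTwo W p → Upper.TwistUnitFieldOffSliverAt W p → BSDp W p :=
  fun W _ _ p _ hr hp2 hX hG hTU =>
    bsdp_of_missingPPartAt W p hF.2.2.1 (le_of_eq hr)
      (missingPPartAt_gordTwo_of_twistUnitAt hF hA hL hCHσ hDVD hAN3 hBR3 h212 hAN5 hprop125 hfact hlift hlocal hRH hPWL h331 h411 hFE hO1 h263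
        h41 h32 W p hr hp2 hX hG hTU)

end Summit.BirchSwinnertonDyer.BirchSwinnertonDyer.Theorems.SchneiderFreeAdditiveX3.KYBranchFiveLePerPair

end
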